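import Summits.BirchSwinnertonDyer.BirchSwinnertonDyer.Theorems.KatoDescentTamePotSupersingularTameUpperRankEqSplitDoors
import Summits.BirchSwinnertonDyer.BirchSwinnertonDyer.Theorems.KatoDescentTamePotSupersingularTameUpperUnitTwistRecordsSharp42
import Summits.BirchSwinnertonDyer.BirchSwinnertonDyer.Theorems.KatoDescentTamePotSupersingularTameUpperMuRoadFiveRecordsSplit02
import Summits.BirchSwinnertonDyer.BirchSwinnertonDyer.Theorems.KatoDescentTamePotSupersingularTameUpperUnitTwistRecordsFlat74
import Summits.BirchSwinnertonDyer.BirchSwinnertonDyer.Theorems.KatoDescentTamePotSupersingularTameUpperUnitTwistRecordsFlat75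
import Summits.BirchSwinnertonDyer.BirchSwinnertonDyer.Theorems.KatoDescentTamePotSupersingularTameUpperUnitTwistRecordsFlat76
import Summits.BirchSwinnertonDyer.BirchSwinnertonDyer.Theorems.KatoDescentTamePotSupersingularTameUpperUnitTwistRecordsFlat77
import HarnessLib

/-!
# Route `KatoDescentTamePotSupersingular` (rung K8, sub-rung B4 (t′), cell `bsd-potss`): μ-FREE U₀ RECORDS at `p = 5` FROM THE LAYER-0 RANK EQUALITY
# `rank_5 Cl(ℚ(P)) = rank_5 Cl(ℚ(x(P)))` — KT `5Ns` rows (full C_s⁺(5) image), part 06 (434400bt1, 434400l1, 435600fa1, 435600pr1, 462400cu1, 462400gs1)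

Seat `bsd-potss-k8t-c4` g26; `--supports stmt-BirchSwinnertonDyer-19982 --as helper`. THEOREMS ONLY (no definition, no named fact, no `sorry`);
nothing booked; (A), Conjecture A and BSD are proved for NO curve here; items 19202 / 19982 stay OPEN at class level (open inputs class-wide: zeta
crux 24439, lower half of 19984).

Per row `E` (Cremona label, `r_an = 0`, additive potentially supersingular (t′) at `5`, mod-`5` image in the normaliser of a split Cartan subgroup —
LMFDB `5Ns`; by the seat's census kit j333447 `#Gal(ℚ(E[5])/ℚ) = 32` (the full normaliser, SmallGroup `[32,11]`); the image is a DISPLAYED hypothesis — the basis data):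
`MissingUpperBoundAt E 5` (`ord₅ #Ш(E) ≤ ord₅ #Ш_an(E)`) from the named facts `hKatoA hGZK hmod`, Cremona's `r_an = 0`, the basis data and the ONE
class-group datum `hrank : #Cl(ℚ(P))[5] = #Cl(ℚ(x(P)))[5]` (`ℚ(P)` of degree 8 and `ℚ(x(P))` of degree 4 for an axis point `P`; BOTH class numbers
CERTIFIED by `bnfcertify`, kit j333447) and the inertia input `hcI : σ̄_u²σ̄_v² (= −1) ∈ I(𝔮|5)` for every prime `𝔮 ∋ 5` of `ℚ(E[5])` (DISPLAYED; numerically every prime of `ℚ(x(E[5]))` above `5` ramifies in `ℚ(E[5])`, kit j333447), through the door `TameRankEqRecords.missingUpperBoundAt_five_tame_of_splitCartanBasis_of_rankEq`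
(k8t-c4 g26, over g25's image-agnostic rank-equality road).  KERNEL per row (tree certificates, cited by name): `E[5]` irreducible, `Addv E 5`,
`SubTprime E 5`.  These rows carried ONLY unit-twist records before (`TameUpperUnitTwistRecords`: the rank-one Heegner twist's BSD inputs displayed);
this is their first Kato-(A) road.  The numerical values are DISPLAYED HYPOTHESES, not certified in Lean.  CONDITIONAL; per row; nothing booked; BSD
for no curve.

References: [Kato2004Asterisque] Thm. 14.5 (3); [CoatesSujatha2005] Thm. 3.4; [Iwasawa1956]; [Serre1972] §2.2, §5.2 (iii); [Cremona2006] Table 1.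
-/

set_option autoImplicit false
-- the Theorems directory repeats the summit name (`Summits/BirchSwinnertonDyer/BirchSwinnertonDyer/…`): house rule of the cell
set_option linter.dupNamespace false

noncomputable section

open scoped Classical NumberField Matrix
open WeierstrassCurve Field IntermediateField
  Literature.NumberTheory.EllipticCurves Literature.NumberTheory.EllipticCurves.Rank1Residual
  Literature.NumberTheory.EllipticCurves.Rank1Residual.Typed
  Literature.NumberTheory.GaloisRepresentations Literature.NumberTheory.SerreUniformity
  Literature.NumberTheory.IwasawaTheory
  Summit.BirchSwinnertonDyer.Rank1Residual Summit.BirchSwinnertonDyer.Rank1Residual.Additive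
  Summit.BirchSwinnertonDyer.BirchSwinnertonDyer.Theorems

namespace Summit.BirchSwinnertonDyer.BirchSwinnertonDyer.Theorems.TameRankEqRecords

/-! ### `434400bt1` @ `p = 5` — `N = 434400 = 2^5·3·5^2·181`; Cremona: `r_an = 0`; (t′) at `5` (Kodaira IV*, e = 3); ♯; image `C_s⁺(5)` (`#Gal = 32`, SmallGroup `[32,11]`; displayed);
layer-0 census (kit j333447): `h(ℚ(x(P))) = 4` [CERT], `h(ℚ(P)) = 4` [CERT] ⇒ `hrank`: `1 = 1`; primes above `5`: `ℚ(x(E[5]))` [[4, 2], [4, 2]], `ℚ(E[5])` [[8, 2], [8, 2]] ⇒ `hcI` numerically. -/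

/-- **CONDITIONAL U₀ for `434400bt1` @ 5 FROM THE LAYER-0 RANK EQUALITY** — `ord₅ #Ш(E) ≤ ord₅ #Ш_an(E)` (`MissingUpperBoundAt E 5`) for
`E = 434400bt1 = [0, 1, 0, -93131458, 530046796088]` (`N = 2^5·3·5^2·181`), from: the named facts `hKatoA hGZK hmod`; Cremona's `r_an = 0` (`hr`); the `C_s⁺(5)` basis data
(`e he σu σv σw hσu hσv hσw`, displayed); the rank equality `#Cl(ℚ(P))[5] = #Cl(ℚ(x(P)))[5]` (`hrank`; numerically `1 = 1`: `h(ℚ(x(P))) = 4` [CERT],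
`h(ℚ(P)) = 4` [CERT], kit j333447); the inertia input `hcI : σ̄_u²σ̄_v² ∈ I(𝔮|5)` (displayed; numerically every prime of `ℚ(x(E[5]))` above `5`
ramifies in `ℚ(E[5])`, kit j333447).  NO `μ`-hypothesis.  KERNEL: `E[5]` irreducible, `Addv`, `SubTprime` (tree: `TameUpperUnitTwistRecords.irr_g434400bt1_5`, `addv_g434400bt1_5`,
`subTprime_g434400bt1_5`).  Per row; CONDITIONAL; nothing booked; BSD is not proved by this. [cite: Kato2004Asterisque, Thm. 14.5 (3) (p. 236)]
[cite: CoatesSujatha2005, §3 Thm. 3.4] [cite: Iwasawa1956, §§3–5] [cite: Cremona2006, Table 1 (Cremona label 434400bt1)] -/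
theorem missingUpperBoundAt_g434400bt1_5_of_rankEq
    (hKatoA : Kato2004.rankZero_padicValNat_sha_add_padicValNat_tamagawa_le_of_additive_potGood_of_irreducible_of_fineSelmerDual_fg)
    (hGZK : rank_eq_analyticRank_of_analyticRank_le_one) (hmod : hasEntireLFunction_rat)
    {W : WeierstrassCurve ℚ} [W.IsElliptic] [W.IsGloballyMinimal] (hWeq : W = (⟨0, 1, 0, (-93131458), 530046796088⟩ : WeierstrassCurve ℚ))
    (hr : W.analyticRank = 0)
    (e : W.geomTorsion (5 : ℕ) ≃+ (Fin 2 → ZMod 5))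
    (he : ∀ σ : absoluteGaloisGroup ℚ, ∃ M ∈ splitCartanNormalizer 5, ∀ P : W.geomTorsion (5 : ℕ), e (σ • P) = M *ᵥ e P)
    (σu σv σw : absoluteGaloisGroup ℚ) (hσu : ∀ P : W.geomTorsion (5 : ℕ), e (σu • P) = !![2, 0; 0, 1] *ᵥ e P)
    (hσv : ∀ P : W.geomTorsion (5 : ℕ), e (σv • P) = !![1, 0; 0, 2] *ᵥ e P)
    (hσw : ∀ P : W.geomTorsion (5 : ℕ), e (σw • P) = !![0, 1; 1, 0] *ᵥ e P)
    (hrank : Nat.card {d : ClassGroup (𝓞 ↥(fixedField (Subgroup.zpowers (absRestrictNormalHom (W.divisionField 5) σv)))) // d ^ 5 = 1} =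
      Nat.card {d : ClassGroup (𝓞 ↥(fixedField (Subgroup.zpowers (absRestrictNormalHom (W.divisionField 5) (σu * σu * (σv * σv))) ⊔
        Subgroup.zpowers (absRestrictNormalHom (W.divisionField 5) σv)))) // d ^ 5 = 1})
    (hcI : ∀ (𝔮 : Ideal (𝓞 ↥(W.divisionField 5))) [𝔮.IsMaximal], ((5 : ℕ) : 𝓞 ↥(W.divisionField 5)) ∈ 𝔮 →
      absRestrictNormalHom (W.divisionField 5) (σu * σu * (σv * σv)) ∈ 𝔮.inertia _) :
    MissingUpperBoundAt W 5 := by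
  subst hWeq
  exact missingUpperBoundAt_five_tame_of_splitCartanBasis_of_rankEq _ hKatoA hGZK hmod hr
    TameUpperUnitTwistRecords.addv_g434400bt1_5 TameUpperUnitTwistRecords.subTprime_g434400bt1_5 TameUpperUnitTwistRecords.irr_g434400bt1_5
    e he σu σv σw hσu hσv hσw hrank hcI

/-! ### `434400l1` @ `p = 5` — `N = 434400 = 2^5·3·5^2·181`; Cremona: `r_an = 0`; (t′) at `5` (Kodaira IV*, e = 3); ♭; image `C_s⁺(5)` (`#Gal = 32`, SmallGroup `[32,11]`; displayed);
layer-0 census (kit j333447): `h(ℚ(x(P))) = 4` [CERT], `h(ℚ(P)) = 4` [CERT] ⇒ `hrank`: `1 = 1`; primes above `5`: `ℚ(x(E[5]))` [[4, 2], [4, 2]], `ℚ(E[5])` [[8, 2], [8, 2]] ⇒ `hcI` numerically. -/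

/-- **CONDITIONAL U₀ for `434400l1` @ 5 FROM THE LAYER-0 RANK EQUALITY** — `ord₅ #Ш(E) ≤ ord₅ #Ш_an(E)` (`MissingUpperBoundAt E 5`) for
`E = 434400l1 = [0, -1, 0, -93131458, -530046796088]` (`N = 2^5·3·5^2·181`), from: the named facts `hKatoA hGZK hmod`; Cremona's `r_an = 0` (`hr`); the `C_s⁺(5)` basis data
(`e he σu σv σw hσu hσv hσw`, displayed); the rank equality `#Cl(ℚ(P))[5] = #Cl(ℚ(x(P)))[5]` (`hrank`; numerically `1 = 1`: `h(ℚ(x(P))) = 4` [CERT],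
`h(ℚ(P)) = 4` [CERT], kit j333447); the inertia input `hcI : σ̄_u²σ̄_v² ∈ I(𝔮|5)` (displayed; numerically every prime of `ℚ(x(E[5]))` above `5`
ramifies in `ℚ(E[5])`, kit j333447).  NO `μ`-hypothesis.  KERNEL: `E[5]` irreducible, `Addv`, `SubTprime` (tree: `TameConjAFiveRecords.irr_g434400l1_5`, `addv_g434400l1_5`,
`subTprime_g434400l1_5`).  Per row; CONDITIONAL; nothing booked; BSD is not proved by this. [cite: Kato2004Asterisque, Thm. 14.5 (3) (p. 236)]
[cite: CoatesSujatha2005, §3 Thm. 3.4] [cite: Iwasawa1956, §§3–5] [cite: Cremona2006, Table 1 (Cremona label 434400l1)] -/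
theorem missingUpperBoundAt_g434400l1_5_of_rankEq
    (hKatoA : Kato2004.rankZero_padicValNat_sha_add_padicValNat_tamagawa_le_of_additive_potGood_of_irreducible_of_fineSelmerDual_fg)
    (hGZK : rank_eq_analyticRank_of_analyticRank_le_one) (hmod : hasEntireLFunction_rat)
    {W : WeierstrassCurve ℚ} [W.IsElliptic] [W.IsGloballyMinimal] (hWeq : W = (⟨0, (-1), 0, (-93131458), (-530046796088)⟩ : WeierstrassCurve ℚ))
    (hr : W.analyticRank = 0)
    (e : W.geomTorsion (5 : ℕ) ≃+ (Fin 2 → ZMod 5))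
    (he : ∀ σ : absoluteGaloisGroup ℚ, ∃ M ∈ splitCartanNormalizer 5, ∀ P : W.geomTorsion (5 : ℕ), e (σ • P) = M *ᵥ e P)
    (σu σv σw : absoluteGaloisGroup ℚ) (hσu : ∀ P : W.geomTorsion (5 : ℕ), e (σu • P) = !![2, 0; 0, 1] *ᵥ e P)
    (hσv : ∀ P : W.geomTorsion (5 : ℕ), e (σv • P) = !![1, 0; 0, 2] *ᵥ e P)
    (hσw : ∀ P : W.geomTorsion (5 : ℕ), e (σw • P) = !![0, 1; 1, 0] *ᵥ e P)
    (hrank : Nat.card {d : ClassGroup (𝓞 ↥(fixedField (Subgroup.zpowers (absRestrictNormalHom (W.divisionField 5) σv)))) // d ^ 5 = 1} =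
      Nat.card {d : ClassGroup (𝓞 ↥(fixedField (Subgroup.zpowers (absRestrictNormalHom (W.divisionField 5) (σu * σu * (σv * σv))) ⊔
        Subgroup.zpowers (absRestrictNormalHom (W.divisionField 5) σv)))) // d ^ 5 = 1})
    (hcI : ∀ (𝔮 : Ideal (𝓞 ↥(W.divisionField 5))) [𝔮.IsMaximal], ((5 : ℕ) : 𝓞 ↥(W.divisionField 5)) ∈ 𝔮 →
      absRestrictNormalHom (W.divisionField 5) (σu * σu * (σv * σv)) ∈ 𝔮.inertia _) :
    MissingUpperBoundAt W 5 := by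
  subst hWeq
  exact missingUpperBoundAt_five_tame_of_splitCartanBasis_of_rankEq _ hKatoA hGZK hmod hr
    TameConjAFiveRecords.addv_g434400l1_5 TameConjAFiveRecords.subTprime_g434400l1_5 TameConjAFiveRecords.irr_g434400l1_5
    e he σu σv σw hσu hσv hσw hrank hcI

/-! ### `435600fa1` @ `p = 5` — `N = 435600 = 2^4·3^2·5^2·11^2`; Cremona: `r_an = 0`; (t′) at `5` (Kodaira IV*, e = 3); ♭; image `C_s⁺(5)` (`#Gal = 32`, SmallGroup `[32,11]`; displayed);
layer-0 census (kit j333447): `h(ℚ(x(P))) = 4` [CERT], `h(ℚ(P)) = 64` [CERT] ⇒ `hrank`: `1 = 1`; primes above `5`: `ℚ(x(E[5]))` [[4, 2], [4, 2]], `ℚ(E[5])` [[8, 2], [8, 2]] ⇒ `hcI` numerically. -/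

/-- **CONDITIONAL U₀ for `435600fa1` @ 5 FROM THE LAYER-0 RANK EQUALITY** — `ord₅ #Ш(E) ≤ ord₅ #Ш_an(E)` (`MissingUpperBoundAt E 5`) for
`E = 435600fa1 = [0, 0, 0, -61875, 12251250]` (`N = 2^4·3^2·5^2·11^2`), from: the named facts `hKatoA hGZK hmod`; Cremona's `r_an = 0` (`hr`); the `C_s⁺(5)` basis data
(`e he σu σv σw hσu hσv hσw`, displayed); the rank equality `#Cl(ℚ(P))[5] = #Cl(ℚ(x(P)))[5]` (`hrank`; numerically `1 = 1`: `h(ℚ(x(P))) = 4` [CERT],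
`h(ℚ(P)) = 64` [CERT], kit j333447); the inertia input `hcI : σ̄_u²σ̄_v² ∈ I(𝔮|5)` (displayed; numerically every prime of `ℚ(x(E[5]))` above `5`
ramifies in `ℚ(E[5])`, kit j333447).  NO `μ`-hypothesis.  KERNEL: `E[5]` irreducible, `Addv`, `SubTprime` (tree: `TameUpperUnitTwistRecords.irr_g435600fa1_5`, `addv_g435600fa1_5`,
`subTprime_g435600fa1_5`).  Per row; CONDITIONAL; nothing booked; BSD is not proved by this. [cite: Kato2004Asterisque, Thm. 14.5 (3) (p. 236)]
[cite: CoatesSujatha2005, §3 Thm. 3.4] [cite: Iwasawa1956, §§3–5] [cite: Cremona2006, Table 1 (Cremona label 435600fa1)] -/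
theorem missingUpperBoundAt_g435600fa1_5_of_rankEq
    (hKatoA : Kato2004.rankZero_padicValNat_sha_add_padicValNat_tamagawa_le_of_additive_potGood_of_irreducible_of_fineSelmerDual_fg)
    (hGZK : rank_eq_analyticRank_of_analyticRank_le_one) (hmod : hasEntireLFunction_rat)
    {W : WeierstrassCurve ℚ} [W.IsElliptic] [W.IsGloballyMinimal] (hWeq : W = (⟨0, 0, 0, (-61875), 12251250⟩ : WeierstrassCurve ℚ))
    (hr : W.analyticRank = 0)
    (e : W.geomTorsion (5 : ℕ) ≃+ (Fin 2 → ZMod 5))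
    (he : ∀ σ : absoluteGaloisGroup ℚ, ∃ M ∈ splitCartanNormalizer 5, ∀ P : W.geomTorsion (5 : ℕ), e (σ • P) = M *ᵥ e P)
    (σu σv σw : absoluteGaloisGroup ℚ) (hσu : ∀ P : W.geomTorsion (5 : ℕ), e (σu • P) = !![2, 0; 0, 1] *ᵥ e P)
    (hσv : ∀ P : W.geomTorsion (5 : ℕ), e (σv • P) = !![1, 0; 0, 2] *ᵥ e P)
    (hσw : ∀ P : W.geomTorsion (5 : ℕ), e (σw • P) = !![0, 1; 1, 0] *ᵥ e P)
    (hrank : Nat.card {d : ClassGroup (𝓞 ↥(fixedField (Subgroup.zpowers (absRestrictNormalHom (W.divisionField 5) σv)))) // d ^ 5 = 1} =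
      Nat.card {d : ClassGroup (𝓞 ↥(fixedField (Subgroup.zpowers (absRestrictNormalHom (W.divisionField 5) (σu * σu * (σv * σv))) ⊔
        Subgroup.zpowers (absRestrictNormalHom (W.divisionField 5) σv)))) // d ^ 5 = 1})
    (hcI : ∀ (𝔮 : Ideal (𝓞 ↥(W.divisionField 5))) [𝔮.IsMaximal], ((5 : ℕ) : 𝓞 ↥(W.divisionField 5)) ∈ 𝔮 →
      absRestrictNormalHom (W.divisionField 5) (σu * σu * (σv * σv)) ∈ 𝔮.inertia _) :
    MissingUpperBoundAt W 5 := by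
  subst hWeq
  exact missingUpperBoundAt_five_tame_of_splitCartanBasis_of_rankEq _ hKatoA hGZK hmod hr
    TameUpperUnitTwistRecords.addv_g435600fa1_5 TameUpperUnitTwistRecords.subTprime_g435600fa1_5 TameUpperUnitTwistRecords.irr_g435600fa1_5
    e he σu σv σw hσu hσv hσw hrank hcI

/-! ### `435600pr1` @ `p = 5` — `N = 435600 = 2^4·3^2·5^2·11^2`; Cremona: `r_an = 0`; (t′) at `5` (Kodaira IV*, e = 3); ♭; image `C_s⁺(5)` (`#Gal = 32`, SmallGroup `[32,11]`; displayed);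
layer-0 census (kit j333447): `h(ℚ(x(P))) = 4` [CERT], `h(ℚ(P)) = 64` [CERT] ⇒ `hrank`: `1 = 1`; primes above `5`: `ℚ(x(E[5]))` [[4, 2], [4, 2]], `ℚ(E[5])` [[8, 2], [8, 2]] ⇒ `hcI` numerically. -/

/-- **CONDITIONAL U₀ for `435600pr1` @ 5 FROM THE LAYER-0 RANK EQUALITY** — `ord₅ #Ш(E) ≤ ord₅ #Ш_an(E)` (`MissingUpperBoundAt E 5`) for
`E = 435600pr1 = [0, 0, 0, -7486875, -16306413750]` (`N = 2^4·3^2·5^2·11^2`), from: the named facts `hKatoA hGZK hmod`; Cremona's `r_an = 0` (`hr`); the `C_s⁺(5)` basis data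
(`e he σu σv σw hσu hσv hσw`, displayed); the rank equality `#Cl(ℚ(P))[5] = #Cl(ℚ(x(P)))[5]` (`hrank`; numerically `1 = 1`: `h(ℚ(x(P))) = 4` [CERT],
`h(ℚ(P)) = 64` [CERT], kit j333447); the inertia input `hcI : σ̄_u²σ̄_v² ∈ I(𝔮|5)` (displayed; numerically every prime of `ℚ(x(E[5]))` above `5`
ramifies in `ℚ(E[5])`, kit j333447).  NO `μ`-hypothesis.  KERNEL: `E[5]` irreducible, `Addv`, `SubTprime` (tree: `TameUpperUnitTwistRecords.irr_g435600pr1_5`, `addv_g435600pr1_5`,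
`subTprime_g435600pr1_5`).  Per row; CONDITIONAL; nothing booked; BSD is not proved by this. [cite: Kato2004Asterisque, Thm. 14.5 (3) (p. 236)]
[cite: CoatesSujatha2005, §3 Thm. 3.4] [cite: Iwasawa1956, §§3–5] [cite: Cremona2006, Table 1 (Cremona label 435600pr1)] -/
theorem missingUpperBoundAt_g435600pr1_5_of_rankEq
    (hKatoA : Kato2004.rankZero_padicValNat_sha_add_padicValNat_tamagawa_le_of_additive_potGood_of_irreducible_of_fineSelmerDual_fg)
    (hGZK : rank_eq_analyticRank_of_analyticRank_le_one) (hmod : hasEntireLFunction_rat)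
    {W : WeierstrassCurve ℚ} [W.IsElliptic] [W.IsGloballyMinimal] (hWeq : W = (⟨0, 0, 0, (-7486875), (-16306413750)⟩ : WeierstrassCurve ℚ))
    (hr : W.analyticRank = 0)
    (e : W.geomTorsion (5 : ℕ) ≃+ (Fin 2 → ZMod 5))
    (he : ∀ σ : absoluteGaloisGroup ℚ, ∃ M ∈ splitCartanNormalizer 5, ∀ P : W.geomTorsion (5 : ℕ), e (σ • P) = M *ᵥ e P)
    (σu σv σw : absoluteGaloisGroup ℚ) (hσu : ∀ P : W.geomTorsion (5 : ℕ), e (σu • P) = !![2, 0; 0, 1] *ᵥ e P)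
    (hσv : ∀ P : W.geomTorsion (5 : ℕ), e (σv • P) = !![1, 0; 0, 2] *ᵥ e P)
    (hσw : ∀ P : W.geomTorsion (5 : ℕ), e (σw • P) = !![0, 1; 1, 0] *ᵥ e P)
    (hrank : Nat.card {d : ClassGroup (𝓞 ↥(fixedField (Subgroup.zpowers (absRestrictNormalHom (W.divisionField 5) σv)))) // d ^ 5 = 1} =
      Nat.card {d : ClassGroup (𝓞 ↥(fixedField (Subgroup.zpowers (absRestrictNormalHom (W.divisionField 5) (σu * σu * (σv * σv))) ⊔
        Subgroup.zpowers (absRestrictNormalHom (W.divisionField 5) σv)))) // d ^ 5 = 1})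
    (hcI : ∀ (𝔮 : Ideal (𝓞 ↥(W.divisionField 5))) [𝔮.IsMaximal], ((5 : ℕ) : 𝓞 ↥(W.divisionField 5)) ∈ 𝔮 →
      absRestrictNormalHom (W.divisionField 5) (σu * σu * (σv * σv)) ∈ 𝔮.inertia _) :
    MissingUpperBoundAt W 5 := by
  subst hWeq
  exact missingUpperBoundAt_five_tame_of_splitCartanBasis_of_rankEq _ hKatoA hGZK hmod hr
    TameUpperUnitTwistRecords.addv_g435600pr1_5 TameUpperUnitTwistRecords.subTprime_g435600pr1_5 TameUpperUnitTwistRecords.irr_g435600pr1_5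
    e he σu σv σw hσu hσv hσw hrank hcI

/-! ### `462400cu1` @ `p = 5` — `N = 462400 = 2^6·5^2·17^2`; Cremona: `r_an = 0`; (t′) at `5` (Kodaira IV*, e = 3); ♭; image `C_s⁺(5)` (`#Gal = 32`, SmallGroup `[32,11]`; displayed);
layer-0 census (kit j333447): `h(ℚ(x(P))) = 4` [CERT], `h(ℚ(P)) = 8` [CERT] ⇒ `hrank`: `1 = 1`; primes above `5`: `ℚ(x(E[5]))` [[4, 2], [4, 2]], `ℚ(E[5])` [[8, 2], [8, 2]] ⇒ `hcI` numerically. -/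

/-- **CONDITIONAL U₀ for `462400cu1` @ 5 FROM THE LAYER-0 RANK EQUALITY** — `ord₅ #Ш(E) ≤ ord₅ #Ш_an(E)` (`MissingUpperBoundAt E 5`) for
`E = 462400cu1 = [0, -1, 0, -240833, 52849537]` (`N = 2^6·5^2·17^2`), from: the named facts `hKatoA hGZK hmod`; Cremona's `r_an = 0` (`hr`); the `C_s⁺(5)` basis data
(`e he σu σv σw hσu hσv hσw`, displayed); the rank equality `#Cl(ℚ(P))[5] = #Cl(ℚ(x(P)))[5]` (`hrank`; numerically `1 = 1`: `h(ℚ(x(P))) = 4` [CERT],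
`h(ℚ(P)) = 8` [CERT], kit j333447); the inertia input `hcI : σ̄_u²σ̄_v² ∈ I(𝔮|5)` (displayed; numerically every prime of `ℚ(x(E[5]))` above `5`
ramifies in `ℚ(E[5])`, kit j333447).  NO `μ`-hypothesis.  KERNEL: `E[5]` irreducible, `Addv`, `SubTprime` (tree: `TameUpperUnitTwistRecords.irr_g462400cu1_5`, `addv_g462400cu1_5`,
`subTprime_g462400cu1_5`).  Per row; CONDITIONAL; nothing booked; BSD is not proved by this. [cite: Kato2004Asterisque, Thm. 14.5 (3) (p. 236)]
[cite: CoatesSujatha2005, §3 Thm. 3.4] [cite: Iwasawa1956, §§3–5] [cite: Cremona2006, Table 1 (Cremona label 462400cu1)] -/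
theorem missingUpperBoundAt_g462400cu1_5_of_rankEq
    (hKatoA : Kato2004.rankZero_padicValNat_sha_add_padicValNat_tamagawa_le_of_additive_potGood_of_irreducible_of_fineSelmerDual_fg)
    (hGZK : rank_eq_analyticRank_of_analyticRank_le_one) (hmod : hasEntireLFunction_rat)
    {W : WeierstrassCurve ℚ} [W.IsElliptic] [W.IsGloballyMinimal] (hWeq : W = (⟨0, (-1), 0, (-240833), 52849537⟩ : WeierstrassCurve ℚ))
    (hr : W.analyticRank = 0)
    (e : W.geomTorsion (5 : ℕ) ≃+ (Fin 2 → ZMod 5))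
    (he : ∀ σ : absoluteGaloisGroup ℚ, ∃ M ∈ splitCartanNormalizer 5, ∀ P : W.geomTorsion (5 : ℕ), e (σ • P) = M *ᵥ e P)
    (σu σv σw : absoluteGaloisGroup ℚ) (hσu : ∀ P : W.geomTorsion (5 : ℕ), e (σu • P) = !![2, 0; 0, 1] *ᵥ e P)
    (hσv : ∀ P : W.geomTorsion (5 : ℕ), e (σv • P) = !![1, 0; 0, 2] *ᵥ e P)
    (hσw : ∀ P : W.geomTorsion (5 : ℕ), e (σw • P) = !![0, 1; 1, 0] *ᵥ e P)
    (hrank : Nat.card {d : ClassGroup (𝓞 ↥(fixedField (Subgroup.zpowers (absRestrictNormalHom (W.divisionField 5) σv)))) // d ^ 5 = 1} =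
      Nat.card {d : ClassGroup (𝓞 ↥(fixedField (Subgroup.zpowers (absRestrictNormalHom (W.divisionField 5) (σu * σu * (σv * σv))) ⊔
        Subgroup.zpowers (absRestrictNormalHom (W.divisionField 5) σv)))) // d ^ 5 = 1})
    (hcI : ∀ (𝔮 : Ideal (𝓞 ↥(W.divisionField 5))) [𝔮.IsMaximal], ((5 : ℕ) : 𝓞 ↥(W.divisionField 5)) ∈ 𝔮 →
      absRestrictNormalHom (W.divisionField 5) (σu * σu * (σv * σv)) ∈ 𝔮.inertia _) :
    MissingUpperBoundAt W 5 := by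
  subst hWeq
  exact missingUpperBoundAt_five_tame_of_splitCartanBasis_of_rankEq _ hKatoA hGZK hmod hr
    TameUpperUnitTwistRecords.addv_g462400cu1_5 TameUpperUnitTwistRecords.subTprime_g462400cu1_5 TameUpperUnitTwistRecords.irr_g462400cu1_5
    e he σu σv σw hσu hσv hσw hrank hcI

/-! ### `462400gs1` @ `p = 5` — `N = 462400 = 2^6·5^2·17^2`; Cremona: `r_an = 0`; (t′) at `5` (Kodaira IV*, e = 3); ♭; image `C_s⁺(5)` (`#Gal = 32`, SmallGroup `[32,11]`; displayed);
layer-0 census (kit j333447): `h(ℚ(x(P))) = 4` [CERT], `h(ℚ(P)) = 8` [CERT] ⇒ `hrank`: `1 = 1`; primes above `5`: `ℚ(x(E[5]))` [[4, 2], [4, 2]], `ℚ(E[5])` [[8, 2], [8, 2]] ⇒ `hcI` numerically. -/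

/-- **CONDITIONAL U₀ for `462400gs1` @ 5 FROM THE LAYER-0 RANK EQUALITY** — `ord₅ #Ш(E) ≤ ord₅ #Ш_an(E)` (`MissingUpperBoundAt E 5`) for
`E = 462400gs1 = [0, 1, 0, -240833, -52849537]` (`N = 2^6·5^2·17^2`), from: the named facts `hKatoA hGZK hmod`; Cremona's `r_an = 0` (`hr`); the `C_s⁺(5)` basis data
(`e he σu σv σw hσu hσv hσw`, displayed); the rank equality `#Cl(ℚ(P))[5] = #Cl(ℚ(x(P)))[5]` (`hrank`; numerically `1 = 1`: `h(ℚ(x(P))) = 4` [CERT],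
`h(ℚ(P)) = 8` [CERT], kit j333447); the inertia input `hcI : σ̄_u²σ̄_v² ∈ I(𝔮|5)` (displayed; numerically every prime of `ℚ(x(E[5]))` above `5`
ramifies in `ℚ(E[5])`, kit j333447).  NO `μ`-hypothesis.  KERNEL: `E[5]` irreducible, `Addv`, `SubTprime` (tree: `TameUpperUnitTwistRecords.irr_g462400gs1_5`, `addv_g462400gs1_5`,
`subTprime_g462400gs1_5`).  Per row; CONDITIONAL; nothing booked; BSD is not proved by this. [cite: Kato2004Asterisque, Thm. 14.5 (3) (p. 236)]
[cite: CoatesSujatha2005, §3 Thm. 3.4] [cite: Iwasawa1956, §§3–5] [cite: Cremona2006, Table 1 (Cremona label 462400gs1)] -/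
theorem missingUpperBoundAt_g462400gs1_5_of_rankEq
    (hKatoA : Kato2004.rankZero_padicValNat_sha_add_padicValNat_tamagawa_le_of_additive_potGood_of_irreducible_of_fineSelmerDual_fg)
    (hGZK : rank_eq_analyticRank_of_analyticRank_le_one) (hmod : hasEntireLFunction_rat)
    {W : WeierstrassCurve ℚ} [W.IsElliptic] [W.IsGloballyMinimal] (hWeq : W = (⟨0, 1, 0, (-240833), (-52849537)⟩ : WeierstrassCurve ℚ))
    (hr : W.analyticRank = 0)
    (e : W.geomTorsion (5 : ℕ) ≃+ (Fin 2 → ZMod 5))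
    (he : ∀ σ : absoluteGaloisGroup ℚ, ∃ M ∈ splitCartanNormalizer 5, ∀ P : W.geomTorsion (5 : ℕ), e (σ • P) = M *ᵥ e P)
    (σu σv σw : absoluteGaloisGroup ℚ) (hσu : ∀ P : W.geomTorsion (5 : ℕ), e (σu • P) = !![2, 0; 0, 1] *ᵥ e P)
    (hσv : ∀ P : W.geomTorsion (5 : ℕ), e (σv • P) = !![1, 0; 0, 2] *ᵥ e P)
    (hσw : ∀ P : W.geomTorsion (5 : ℕ), e (σw • P) = !![0, 1; 1, 0] *ᵥ e P)
    (hrank : Nat.card {d : ClassGroup (𝓞 ↥(fixedField (Subgroup.zpowers (absRestrictNormalHom (W.divisionField 5) σv)))) // d ^ 5 = 1} =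
      Nat.card {d : ClassGroup (𝓞 ↥(fixedField (Subgroup.zpowers (absRestrictNormalHom (W.divisionField 5) (σu * σu * (σv * σv))) ⊔
        Subgroup.zpowers (absRestrictNormalHom (W.divisionField 5) σv)))) // d ^ 5 = 1})
    (hcI : ∀ (𝔮 : Ideal (𝓞 ↥(W.divisionField 5))) [𝔮.IsMaximal], ((5 : ℕ) : 𝓞 ↥(W.divisionField 5)) ∈ 𝔮 →
      absRestrictNormalHom (W.divisionField 5) (σu * σu * (σv * σv)) ∈ 𝔮.inertia _) :
    MissingUpperBoundAt W 5 := by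
  subst hWeq
  exact missingUpperBoundAt_five_tame_of_splitCartanBasis_of_rankEq _ hKatoA hGZK hmod hr
    TameUpperUnitTwistRecords.addv_g462400gs1_5 TameUpperUnitTwistRecords.subTprime_g462400gs1_5 TameUpperUnitTwistRecords.irr_g462400gs1_5
    e he σu σv σw hσu hσv hσw hrank hcI

end Summit.BirchSwinnertonDyer.BirchSwinnertonDyer.Theorems.TameRankEqRecords

end
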